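import Literature.ModelTheory.FiniteModelTheory.CPTCardProgram
import HarnessLib

/-!
# CPT+Card is closed under complement, intersection and union (proved)

Topic `Literature/ModelTheory/FiniteModelTheory`; companion of `CPTCardProgram.lean`. The class
`CPTCardDefinable` of Boolean graph queries decided by PTime-bounded BGS programs with counting
(Blass–Gurevich–Shelah 1999/2002) is closed under COMPLEMENT: from a bounded program
`(Π, p, q)` deciding `C` we build `(Π', p + 1, q)` deciding `Cᶜ`, where `Π'` runs `Π` on the
dynamic symbols shifted by `2` (so that `Halt`, `Output` of `Π` become the private `Halt'`,
`Output'`) until `Halt'` holds, and then, in one more step, sets `Halt := true`,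
`Output := ¬ Output'`:

  `Π' = if Halt' = true then do-in-parallel Halt := true, Output := ¬Output' enddo else Π[f ↦ f+2] endif`.

Ingredients: renaming of dynamic symbols in terms/rules (`Term.renameDyn`, `Rule.renameDyn`)
with the simulation lemmas `Term.eval_renameDyn` (values in `S` of the renamed term = values of
the term in `S ∘ ρ`) and `Rule.den_renameDyn`, the behaviour of `fire` under an injective
renaming (`precomp_fire_image`), and the bookkeeping of critical/active objects (the two runs
activate the same objects: the extra step only writes Booleans into nullary locations). This is
the complement third of the Boolean closure of CPT+Card used by the interface `CPTInterface`
(`CPT.lean`, field `compl_mem`); BGS do not print it as a theorem (it is implicit in 1999 §5.1,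
where accepting and rejecting are symmetric), so it is proved here rather than vendored.

## References

* A. Blass, Y. Gurevich, S. Shelah, *Choiceless polynomial time*, Ann. Pure Appl. Logic 100
  (1999) = arXiv:math/9705225, §5.1 (accept / reject), §6.3 (the same `do-in-parallel` trick
  for time-explicit programs, Lemma 8).
* A. Blass, Y. Gurevich, S. Shelah, J. Symbolic Logic 67 (2002) = arXiv:math/0102059, §2.
-/

noncomputable section

namespace Literature.ModelTheory.FiniteModelTheory

namespace BGS

variable {n : ℕ}

/-! ### Renaming dynamic symbols -/

mutual
/-- Rename the dynamic symbols of a term along `ρ`. [folklore] -/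
def Term.renameDyn (ρ : ℕ → ℕ) : Term → Term
  | .var v => .var v
  | .empty => .empty
  | .atoms => .atoms
  | .sUnion t => .sUnion (t.renameDyn ρ)
  | .theUnique t => .theUnique (t.renameDyn ρ)
  | .pair s t => .pair (s.renameDyn ρ) (t.renameDyn ρ)
  | .card t => .card (t.renameDyn ρ)
  | .mem s t => .mem (s.renameDyn ρ) (t.renameDyn ρ)
  | .eq s t => .eq (s.renameDyn ρ) (t.renameDyn ρ)
  | .cTrue => .cTrue
  | .cFalse => .cFalse
  | .not t => .not (t.renameDyn ρ)
  | .and s t => .and (s.renameDyn ρ) (t.renameDyn ρ)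
  | .or s t => .or (s.renameDyn ρ) (t.renameDyn ρ)
  | .edge s t => .edge (s.renameDyn ρ) (t.renameDyn ρ)
  | .dyn f args => .dyn (ρ f) (args.renameDyn ρ)
  | .compr v t r g => .compr v (t.renameDyn ρ) (r.renameDyn ρ) (g.renameDyn ρ)
/-- Rename the dynamic symbols of an argument list along `ρ`. [folklore] -/
def Args.renameDyn (ρ : ℕ → ℕ) : Args → Args
  | .nil => .nil
  | .cons t rest => .cons (t.renameDyn ρ) (rest.renameDyn ρ)
end

/-- Rename the dynamic symbols of a rule along `ρ`. [folklore] -/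
def Rule.renameDyn (ρ : ℕ → ℕ) : Rule → Rule
  | .skip => .skip
  | .update f args t => .update (ρ f) (args.renameDyn ρ) (t.renameDyn ρ)
  | .cond g R₁ R₂ => .cond (g.renameDyn ρ) (R₁.renameDyn ρ) (R₂.renameDyn ρ)
  | .forallDo v r R => .forallDo v (r.renameDyn ρ) (R.renameDyn ρ)

mutual
/-- Renaming dynamic symbols does not change free variables. [folklore] -/
theorem Term.FV_renameDyn (ρ : ℕ → ℕ) : ∀ t : Term, (t.renameDyn ρ).FV = t.FV
  | .var _ => rfl
  | .empty => rfl
  | .atoms => rfl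
  | .sUnion t => by rw [Term.renameDyn, Term.FV, Term.FV, Term.FV_renameDyn ρ t]
  | .theUnique t => by rw [Term.renameDyn, Term.FV, Term.FV, Term.FV_renameDyn ρ t]
  | .pair s t => by
    rw [Term.renameDyn, Term.FV, Term.FV, Term.FV_renameDyn ρ s, Term.FV_renameDyn ρ t]
  | .card t => by rw [Term.renameDyn, Term.FV, Term.FV, Term.FV_renameDyn ρ t]
  | .mem s t => by
    rw [Term.renameDyn, Term.FV, Term.FV, Term.FV_renameDyn ρ s, Term.FV_renameDyn ρ t]
  | .eq s t => by
    rw [Term.renameDyn, Term.FV, Term.FV, Term.FV_renameDyn ρ s, Term.FV_renameDyn ρ t]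
  | .cTrue => rfl
  | .cFalse => rfl
  | .not t => by rw [Term.renameDyn, Term.FV, Term.FV, Term.FV_renameDyn ρ t]
  | .and s t => by
    rw [Term.renameDyn, Term.FV, Term.FV, Term.FV_renameDyn ρ s, Term.FV_renameDyn ρ t]
  | .or s t => by
    rw [Term.renameDyn, Term.FV, Term.FV, Term.FV_renameDyn ρ s, Term.FV_renameDyn ρ t]
  | .edge s t => by
    rw [Term.renameDyn, Term.FV, Term.FV, Term.FV_renameDyn ρ s, Term.FV_renameDyn ρ t]
  | .dyn f args => by rw [Term.renameDyn, Term.FV, Term.FV, Args.FV_renameDyn ρ args]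
  | .compr v t r g => by
    rw [Term.renameDyn, Term.FV, Term.FV, Term.FV_renameDyn ρ t, Term.FV_renameDyn ρ r,
      Term.FV_renameDyn ρ g]
/-- Renaming dynamic symbols does not change free variables (argument lists). [folklore] -/
theorem Args.FV_renameDyn (ρ : ℕ → ℕ) : ∀ args : Args, (args.renameDyn ρ).FV = args.FV
  | .nil => rfl
  | .cons t rest => by
    rw [Args.renameDyn, Args.FV, Args.FV, Term.FV_renameDyn ρ t, Args.FV_renameDyn ρ rest]
end

/-- Renaming dynamic symbols does not change free variables (rules). [folklore] -/
theorem Rule.FV_renameDyn (ρ : ℕ → ℕ) : ∀ R : Rule, (R.renameDyn ρ).FV = R.FV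
  | .skip => rfl
  | .update f args t => by
    rw [Rule.renameDyn, Rule.FV, Rule.FV, Args.FV_renameDyn, Term.FV_renameDyn]
  | .cond g R₁ R₂ => by
    rw [Rule.renameDyn, Rule.FV, Rule.FV, Term.FV_renameDyn, Rule.FV_renameDyn ρ R₁,
      Rule.FV_renameDyn ρ R₂]
  | .forallDo v r R => by
    rw [Rule.renameDyn, Rule.FV, Rule.FV, Term.FV_renameDyn, Rule.FV_renameDyn ρ R]

/-- The state seen through a renaming: `(S ∘ ρ) f = S (ρ f)`. [folklore] -/
def DynState.precomp (S : DynState n) (ρ : ℕ → ℕ) : DynState n := fun f args => S (ρ f) args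

section Rename

variable (ρ : ℕ → ℕ) (G : SimpleGraph (Fin n)) (S : DynState n)

mutual
/-- **Simulation lemma for terms**: the renamed term evaluated in `S` is the term evaluated in
`S ∘ ρ`. [folklore] -/
theorem Term.eval_renameDyn : ∀ (t : Term) (σ : Env n),
    (t.renameDyn ρ).eval G S σ = t.eval G (S.precomp ρ) σ
  | .var _, _ => rfl
  | .empty, _ => rfl
  | .atoms, _ => rfl
  | .sUnion t, σ => by rw [Term.renameDyn, Term.eval, Term.eval, Term.eval_renameDyn t σ]
  | .theUnique t, σ => by rw [Term.renameDyn, Term.eval, Term.eval, Term.eval_renameDyn t σ]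
  | .pair s t, σ => by
    rw [Term.renameDyn, Term.eval, Term.eval, Term.eval_renameDyn s σ, Term.eval_renameDyn t σ]
  | .card t, σ => by rw [Term.renameDyn, Term.eval, Term.eval, Term.eval_renameDyn t σ]
  | .mem s t, σ => by
    rw [Term.renameDyn, Term.eval, Term.eval, Term.eval_renameDyn s σ, Term.eval_renameDyn t σ]
  | .eq s t, σ => by
    rw [Term.renameDyn, Term.eval, Term.eval, Term.eval_renameDyn s σ, Term.eval_renameDyn t σ]
  | .cTrue, _ => rfl
  | .cFalse, _ => rfl
  | .not t, σ => by rw [Term.renameDyn, Term.eval, Term.eval, Term.eval_renameDyn t σ]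
  | .and s t, σ => by
    rw [Term.renameDyn, Term.eval, Term.eval, Term.eval_renameDyn s σ, Term.eval_renameDyn t σ]
  | .or s t, σ => by
    rw [Term.renameDyn, Term.eval, Term.eval, Term.eval_renameDyn s σ, Term.eval_renameDyn t σ]
  | .edge s t, σ => by
    rw [Term.renameDyn, Term.eval, Term.eval, Term.eval_renameDyn s σ, Term.eval_renameDyn t σ]
  | .dyn f args, σ => by
    rw [Term.renameDyn, Term.eval, Term.eval, Args.eval_renameDyn args σ]
    rfl
  | .compr v t r g, σ => by
    have iht : ∀ a, (t.renameDyn ρ).eval G S (Function.update σ v a) =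
        t.eval G (S.precomp ρ) (Function.update σ v a) := fun a => Term.eval_renameDyn t _
    have ihg : ∀ a, (g.renameDyn ρ).eval G S (Function.update σ v a) =
        g.eval G (S.precomp ρ) (Function.update σ v a) := fun a => Term.eval_renameDyn g _
    rw [Term.renameDyn, Term.eval, Term.eval, Term.eval_renameDyn r σ]
    simp only [iht, ihg]
/-- Simulation lemma for argument lists. [folklore] -/
theorem Args.eval_renameDyn : ∀ (args : Args) (σ : Env n),
    (args.renameDyn ρ).eval G S σ = args.eval G (S.precomp ρ) σ
  | .nil, _ => rfl
  | .cons t rest, σ => by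
    rw [Args.renameDyn, Args.eval, Args.eval, Term.eval_renameDyn t σ, Args.eval_renameDyn rest σ]
end

/-- Transport of an update along a renaming of symbols. [folklore] -/
def renUpd (u : Update n) : Update n := ((ρ u.1.1, u.1.2), u.2)

/-- **Simulation lemma for rules**: the update set of the renamed rule in `S` is the renamed
update set of the rule in `S ∘ ρ`. [folklore] -/
theorem Rule.den_renameDyn : ∀ (R : Rule) (σ : Env n),
    (R.renameDyn ρ).den G S σ = (R.den G (S.precomp ρ) σ).image (renUpd ρ)
  | .skip, _ => by rw [Rule.renameDyn, Rule.den, Rule.den, Finset.image_empty]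
  | .update f args t, σ => by
    rw [Rule.renameDyn, Rule.den, Rule.den, Finset.image_singleton, Args.eval_renameDyn,
      Term.eval_renameDyn]
    rfl
  | .cond g R₁ R₂, σ => by
    rw [Rule.renameDyn, Rule.den, Rule.den, Term.eval_renameDyn]
    split_ifs
    · exact Rule.den_renameDyn R₁ σ
    · exact Rule.den_renameDyn R₂ σ
  | .forallDo v r R, σ => by
    rw [Rule.renameDyn, Rule.den, Rule.den, Term.eval_renameDyn, Finset.biUnion_image]
    exact Finset.biUnion_congr rfl fun a _ => Rule.den_renameDyn R _

variable {ρ}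

/-- For injective `ρ`, renaming an action preserves (in)consistency. [folklore] -/
theorem consistent_image_renUpd_iff (hρ : Function.Injective ρ) (U : Finset (Update n)) :
    Consistent (U.image (renUpd ρ)) ↔ Consistent U := by
  constructor
  · intro h u hu u' hu' hl
    have hloc : (renUpd ρ u).1 = (renUpd ρ u').1 := by
      show (ρ u.1.1, u.1.2) = (ρ u'.1.1, u'.1.2)
      rw [hl]
    exact h (renUpd ρ u) (Finset.mem_image_of_mem _ hu) (renUpd ρ u')
      (Finset.mem_image_of_mem _ hu') hloc
  · intro h w hw w' hw' hl
    obtain ⟨u, hu, rfl⟩ := Finset.mem_image.mp hw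
    obtain ⟨u', hu', rfl⟩ := Finset.mem_image.mp hw'
    simp only [renUpd, Prod.mk.injEq] at hl ⊢
    exact h u hu u' hu' (Prod.ext (hρ hl.1) hl.2)

/-- **Firing a renamed action**, seen through the renaming, is firing the action (injective
`ρ`). [folklore] -/
theorem precomp_fire_image (hρ : Function.Injective ρ) (U : Finset (Update n)) :
    (fire S (U.image (renUpd ρ))).precomp ρ = fire (S.precomp ρ) U := by
  funext f args
  show fire S (U.image (renUpd ρ)) (ρ f) args = fire (S.precomp ρ) U f args
  by_cases hU : Consistent U
  · have hU' : Consistent (U.image (renUpd ρ)) := (consistent_image_renUpd_iff hρ U).mpr hU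
    by_cases hex : ∃ b, ((f, args), b) ∈ U
    · obtain ⟨b, hb⟩ := hex
      have hb' : ((ρ f, args), b) ∈ U.image (renUpd ρ) :=
        Finset.mem_image.mpr ⟨((f, args), b), hb, rfl⟩
      rw [fire_apply_of_mem hU' hb', fire_apply_of_mem hU hb]
    · have hno : ∀ b, ((f, args), b) ∉ U := fun b hb => hex ⟨b, hb⟩
      have hno' : ∀ b, ((ρ f, args), b) ∉ U.image (renUpd ρ) := by
        intro b hb
        obtain ⟨⟨⟨f₀, args₀⟩, b₀⟩, hu, hu'⟩ := Finset.mem_image.mp hb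
        simp only [renUpd, Prod.mk.injEq] at hu'
        obtain ⟨⟨hf, rfl⟩, rfl⟩ := hu'
        exact hno b₀ (hρ hf ▸ hu)
      rw [fire_apply_of_forall_not_mem hno', fire_apply_of_forall_not_mem hno]
      rfl
  · have hU' : ¬ Consistent (U.image (renUpd ρ)) := fun h =>
      hU ((consistent_image_renUpd_iff hρ U).mp h)
    rw [fire_of_not_consistent hU, fire_of_not_consistent hU']
    rfl

/-- Firing a renamed action does not touch symbols outside the range of the renaming.
[folklore] -/
theorem fire_image_apply_of_not_mem_range {f : ℕ} (hf : ∀ g, ρ g ≠ f) (U : Finset (Update n))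
    (args : List (Obj n)) : fire S (U.image (renUpd ρ)) f args = S f args := by
  refine fire_apply_of_forall_not_mem fun b hb => ?_
  obtain ⟨u, -, hu⟩ := Finset.mem_image.mp hb
  exact hf u.1.1 (congrArg (fun w : Update n => w.1.1) hu)

end Rename

/-! ### Coincidence: values depend only on the free variables -/

section Coincidence

variable (G : SimpleGraph (Fin n)) (S : DynState n)

mutual
/-- **Coincidence lemma**: the value of a term depends only on the values of the environment at
its free variables. [Blass–Gurevich–Shelah 1999, §4.4] [folklore] -/
theorem Term.eval_congr_env : ∀ (t : Term) {σ τ : Env n}, (∀ v ∈ t.FV, σ v = τ v) →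
    t.eval G S σ = t.eval G S τ
  | .var v, _, _, h => h v (by rw [Term.FV]; exact Finset.mem_singleton_self v)
  | .empty, _, _, _ => rfl
  | .atoms, _, _, _ => rfl
  | .sUnion t, _, _, h => by
    rw [Term.eval, Term.eval, Term.eval_congr_env t fun v hv => h v (by rw [Term.FV]; exact hv)]
  | .theUnique t, _, _, h => by
    rw [Term.eval, Term.eval, Term.eval_congr_env t fun v hv => h v (by rw [Term.FV]; exact hv)]
  | .pair s t, _, _, h => by
    simp only [Term.FV, Finset.mem_union] at h
    rw [Term.eval, Term.eval, Term.eval_congr_env s fun v hv => h v (Or.inl hv),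
      Term.eval_congr_env t fun v hv => h v (Or.inr hv)]
  | .card t, _, _, h => by
    rw [Term.eval, Term.eval, Term.eval_congr_env t fun v hv => h v (by rw [Term.FV]; exact hv)]
  | .mem s t, _, _, h => by
    simp only [Term.FV, Finset.mem_union] at h
    rw [Term.eval, Term.eval, Term.eval_congr_env s fun v hv => h v (Or.inl hv),
      Term.eval_congr_env t fun v hv => h v (Or.inr hv)]
  | .eq s t, _, _, h => by
    simp only [Term.FV, Finset.mem_union] at h
    rw [Term.eval, Term.eval, Term.eval_congr_env s fun v hv => h v (Or.inl hv),
      Term.eval_congr_env t fun v hv => h v (Or.inr hv)]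
  | .cTrue, _, _, _ => rfl
  | .cFalse, _, _, _ => rfl
  | .not t, _, _, h => by
    rw [Term.eval, Term.eval, Term.eval_congr_env t fun v hv => h v (by rw [Term.FV]; exact hv)]
  | .and s t, _, _, h => by
    simp only [Term.FV, Finset.mem_union] at h
    rw [Term.eval, Term.eval, Term.eval_congr_env s fun v hv => h v (Or.inl hv),
      Term.eval_congr_env t fun v hv => h v (Or.inr hv)]
  | .or s t, _, _, h => by
    simp only [Term.FV, Finset.mem_union] at h
    rw [Term.eval, Term.eval, Term.eval_congr_env s fun v hv => h v (Or.inl hv),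
      Term.eval_congr_env t fun v hv => h v (Or.inr hv)]
  | .edge s t, _, _, h => by
    simp only [Term.FV, Finset.mem_union] at h
    rw [Term.eval, Term.eval, Term.eval_congr_env s fun v hv => h v (Or.inl hv),
      Term.eval_congr_env t fun v hv => h v (Or.inr hv)]
  | .dyn f args, _, _, h => by
    rw [Term.eval, Term.eval, Args.eval_congr_env args fun v hv => h v (by rw [Term.FV]; exact hv)]
  | .compr v t r g, σ, τ, h => by
    simp only [Term.FV, Finset.mem_union, Finset.mem_erase] at h
    have hr : r.eval G S σ = r.eval G S τ := Term.eval_congr_env r fun w hw => h w (Or.inl hw)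
    have hupd : ∀ (a : Obj n) (w : ℕ), w ∈ t.FV ∨ w ∈ g.FV →
        Function.update σ v a w = Function.update τ v a w := by
      intro a w hw
      by_cases hwv : w = v
      · subst hwv; rw [Function.update_self, Function.update_self]
      · rw [Function.update_of_ne hwv, Function.update_of_ne hwv]
        exact h w (Or.inr ⟨hwv, hw⟩)
    have ht : ∀ a, t.eval G S (Function.update σ v a) = t.eval G S (Function.update τ v a) :=
      fun a => Term.eval_congr_env t fun w hw => hupd a w (Or.inl hw)
    have hg : ∀ a, g.eval G S (Function.update σ v a) = g.eval G S (Function.update τ v a) :=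
      fun a => Term.eval_congr_env g fun w hw => hupd a w (Or.inr hw)
    rw [Term.eval, Term.eval, hr]
    simp only [ht, hg]
/-- Coincidence lemma for argument lists. [folklore] -/
theorem Args.eval_congr_env : ∀ (args : Args) {σ τ : Env n}, (∀ v ∈ args.FV, σ v = τ v) →
    args.eval G S σ = args.eval G S τ
  | .nil, _, _, _ => rfl
  | .cons t rest, _, _, h => by
    simp only [Args.FV, Finset.mem_union] at h
    rw [Args.eval, Args.eval, Term.eval_congr_env t fun v hv => h v (Or.inl hv),
      Args.eval_congr_env rest fun v hv => h v (Or.inr hv)]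
end

/-- Coincidence lemma for rules: the update set depends only on the environment at the free
variables. [Blass–Gurevich–Shelah 1999, §4.6] [folklore] -/
theorem Rule.den_congr_env : ∀ (R : Rule) {σ τ : Env n}, (∀ v ∈ R.FV, σ v = τ v) →
    R.den G S σ = R.den G S τ
  | .skip, _, _, _ => rfl
  | .update f args t, _, _, h => by
    simp only [Rule.FV, Finset.mem_union] at h
    rw [Rule.den, Rule.den, Args.eval_congr_env G S args fun v hv => h v (Or.inl hv),
      Term.eval_congr_env G S t fun v hv => h v (Or.inr hv)]
  | .cond g R₁ R₂, _, _, h => by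
    simp only [Rule.FV, Finset.mem_union] at h
    rw [Rule.den, Rule.den, Term.eval_congr_env G S g fun v hv => h v (Or.inl (Or.inl hv)),
      Rule.den_congr_env R₁ fun v hv => h v (Or.inl (Or.inr hv)),
      Rule.den_congr_env R₂ fun v hv => h v (Or.inr hv)]
  | .forallDo v r R, σ, τ, h => by
    simp only [Rule.FV, Finset.mem_union, Finset.mem_erase] at h
    rw [Rule.den, Rule.den, Term.eval_congr_env G S r fun w hw => h w (Or.inl hw)]
    refine Finset.biUnion_congr rfl fun a _ => Rule.den_congr_env R fun w hw => ?_
    by_cases hwv : w = v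
    · subst hwv; rw [Function.update_self, Function.update_self]
    · rw [Function.update_of_ne hwv, Function.update_of_ne hwv]
      exact h w (Or.inr ⟨hwv, hw⟩)

/-- A CLOSED rule has the same update set under every environment. [Blass–Gurevich–Shelah 1999,
§4.7] [folklore] -/
theorem Rule.den_eq_of_closed {R : Rule} (hR : R.FV = ∅) (σ τ : Env n) :
    R.den G S σ = R.den G S τ :=
  Rule.den_congr_env G S R fun v hv => by rw [hR] at hv; exact (Finset.notMem_empty v hv).elim

end Coincidence

/-! ### Determinism: a halting run has consistent actions before it halts -/

/-- If a step does not change the state, the run is constant from then on. [folklore] -/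
theorem Program.stateAt_eq_of_step_eq (P : Program) (G : SimpleGraph (Fin n)) {i : ℕ}
    (h : P.stateAt G (i + 1) = P.stateAt G i) : ∀ j, i ≤ j → P.stateAt G j = P.stateAt G i := by
  intro j hij
  obtain ⟨k, rfl⟩ := Nat.exists_eq_add_of_le hij
  induction k with
  | zero => rfl
  | succ k ih =>
    rw [← Nat.add_assoc, Program.stateAt_succ, ih (Nat.le_add_right _ _), ← Program.stateAt_succ, h]

/-- In a halting run the actions fired before the halting stage are consistent (an inconsistent
action freezes the run, which would then never halt). [Blass–Gurevich–Shelah 1999, §4.6–4.7]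
[folklore] -/
theorem Program.consistent_den_of_haltsAt {P : Program} {G : SimpleGraph (Fin n)} {l : ℕ}
    (hl : P.HaltsAt G l) {i : ℕ} (hi : i < l) (σ : Env n) :
    Consistent (P.rule.den G (P.stateAt G i) σ) := by
  by_contra hc
  have hstep : P.stateAt G (i + 1) = P.stateAt G i := by
    rw [Program.stateAt_succ, Program.step, Rule.den_eq_of_closed G _ P.closed (fun _ => ∅) σ,
      fire_of_not_consistent hc]
  have := P.stateAt_eq_of_step_eq G hstep l hi.le
  exact hl.1 i hi (by rw [← this]; exact hl.2)

/-! ### Actions on disjoint sets of symbols -/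

/-- A sub-action of a consistent action is consistent. [folklore] -/
theorem Consistent.mono {U V : Finset (Update n)} (h : U ⊆ V) (hV : Consistent V) : Consistent U :=
  fun u hu u' hu' => hV u (h hu) u' (h hu')

/-- The union of two consistent actions on disjoint sets of symbols is consistent. [folklore] -/
theorem consistent_union {A B : Finset (Update n)} (hA : Consistent A) (hB : Consistent B)
    (hdisj : ∀ a ∈ A, ∀ b ∈ B, a.1.1 ≠ b.1.1) : Consistent (A ∪ B) := by
  intro u hu u' hu' hl
  rcases Finset.mem_union.mp hu with hu | hu <;> rcases Finset.mem_union.mp hu' with hu' | hu'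
  · exact hA u hu u' hu' hl
  · exact (hdisj u hu u' hu' (congrArg Prod.fst hl)).elim
  · exact (hdisj u' hu' u hu (congrArg Prod.fst hl).symm).elim
  · exact hB u hu u' hu' hl

/-- Firing `A ∪ B` at a location untouched by `B` is firing `A` there (when `A ∪ B` is
consistent). [folklore] -/
theorem fire_union_apply_of_forall_not_mem_right (S : DynState n) {A B : Finset (Update n)}
    (hAB : Consistent (A ∪ B)) {f : ℕ} {args : List (Obj n)} (hB : ∀ b, ((f, args), b) ∉ B) :
    fire S (A ∪ B) f args = fire S A f args := by
  have hA : Consistent A := hAB.mono Finset.subset_union_left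
  by_cases hex : ∃ b, ((f, args), b) ∈ A
  · obtain ⟨b, hb⟩ := hex
    rw [fire_apply_of_mem hAB (Finset.mem_union_left _ hb), fire_apply_of_mem hA hb]
  · have hno : ∀ b, ((f, args), b) ∉ A := fun b hb => hex ⟨b, hb⟩
    rw [fire_apply_of_forall_not_mem hno, fire_apply_of_forall_not_mem]
    intro b hb
    rcases Finset.mem_union.mp hb with hb | hb
    · exact hno b hb
    · exact hB b hb

/-- **Firing the union of a renamed action and a foreign consistent action**, seen through the
renaming, is firing the action: the symbols of `B` lie outside the range of the injective `ρ`.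
[folklore] -/
theorem precomp_fire_union (S : DynState n) {ρ : ℕ → ℕ} (hρ : Function.Injective ρ)
    (U : Finset (Update n)) {B : Finset (Update n)} (hB : Consistent B)
    (hout : ∀ b ∈ B, ∀ g, ρ g ≠ b.1.1) :
    (fire S (U.image (renUpd ρ) ∪ B)).precomp ρ = fire (S.precomp ρ) U := by
  by_cases hAB : Consistent (U.image (renUpd ρ) ∪ B)
  · rw [← precomp_fire_image S hρ U]
    funext f args
    show fire S (U.image (renUpd ρ) ∪ B) (ρ f) args = fire S (U.image (renUpd ρ)) (ρ f) args
    exact fire_union_apply_of_forall_not_mem_right S hAB fun b hb => hout _ hb f rfl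
  · have hA : ¬ Consistent (U.image (renUpd ρ)) := fun hA => hAB (consistent_union hA hB
      fun a ha b hb hab => by
        obtain ⟨u, -, rfl⟩ := Finset.mem_image.mp ha
        exact hout b hb u.1.1 hab)
    have hU : ¬ Consistent U := fun h => hA ((consistent_image_renUpd_iff hρ U).mpr h)
    rw [fire_of_not_consistent hAB, fire_of_not_consistent hU]

/-- Symbols occurring in no update are untouched by firing. [folklore] -/
theorem fire_apply_of_forall_sym_ne (S : DynState n) (U : Finset (Update n)) {f : ℕ}
    (hf : ∀ u ∈ U, u.1.1 ≠ f) (args : List (Obj n)) : fire S U f args = S f args :=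
  fire_apply_of_forall_not_mem fun _ hb => hf _ hb rfl

/-! ### `do-in-parallel` and writing `Halt`/`Output` -/

/-- The update set of `do-in-parallel R₀, R₁ enddo`: the union of the two update sets (under the
environments binding the auxiliary variable to `0`, resp. `1`). [Blass–Gurevich–Shelah 1999,
§4.5–4.6] [folklore] -/
theorem den_par (v : ℕ) (R₀ R₁ : Rule) (G : SimpleGraph (Fin n)) (S : DynState n) (σ : Env n) :
    (Rule.par v R₀ R₁).den G S σ = R₀.den G S (Function.update σ v (HF.ofBool false)) ∪
      R₁.den G S (Function.update σ v (HF.ofBool true)) := by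
  have h01 : (HF.ofBool false : Obj n) ≠ HF.ofBool true := by simp
  have hden : ∀ a : Obj n, (Rule.cond (.eq (.var v) .cFalse) R₀ R₁).den G S (Function.update σ v a) =
      if eqB a (HF.ofBool false) = HF.ofBool true then R₀.den G S (Function.update σ v a)
      else R₁.den G S (Function.update σ v a) := by
    intro a
    show (if eqB (Function.update σ v a v) (HF.ofBool false) = HF.ofBool true then _ else _) = _
    rw [Function.update_self]
  have hpair : ∀ a : Obj n, a ∈ (Term.eval G S (.pair .cFalse .cTrue) σ).members ↔
      a = HF.ofBool false ∨ a = HF.ofBool true := fun a => by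
    rw [HF.mem_members]
    exact HF.mem_pair
  ext u
  rw [Rule.par, Rule.den, Finset.mem_biUnion, Finset.mem_union]
  constructor
  · rintro ⟨a, ha, hu⟩
    rw [hden] at hu
    rcases (hpair a).mp ha with rfl | rfl
    · rw [eqB_self, if_pos rfl] at hu
      exact Or.inl hu
    · rw [eqB_of_ne h01.symm, if_neg h01] at hu
      exact Or.inr hu
  · rintro (hu | hu)
    · refine ⟨HF.ofBool false, (hpair _).mpr (Or.inl rfl), ?_⟩
      rw [hden, eqB_self, if_pos rfl]
      exact hu
    · refine ⟨HF.ofBool true, (hpair _).mpr (Or.inr rfl), ?_⟩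
      rw [hden, eqB_of_ne h01.symm, if_neg h01]
      exact hu

/-- `do-in-parallel` of closed rules: the plain union of the update sets. [folklore] -/
theorem den_par_of_closed (v : ℕ) {R₀ R₁ : Rule} (h₀ : R₀.FV = ∅) (h₁ : R₁.FV = ∅)
    (G : SimpleGraph (Fin n)) (S : DynState n) (σ : Env n) :
    (Rule.par v R₀ R₁).den G S σ = R₀.den G S σ ∪ R₁.den G S σ := by
  rw [den_par, Rule.den_eq_of_closed G S h₀ _ σ, Rule.den_eq_of_closed G S h₁ _ σ]

/-- `eqB x y = true ↔ x = y`. [folklore] -/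
theorem eqB_eq_true_iff {x y : Obj n} : eqB x y = HF.ofBool true ↔ x = y := by
  by_cases h : x = y
  · subst h; simp
  · rw [eqB_of_ne h]; simp [h]

/-- `bnot`, `band`, `bor` take Boolean values. [folklore] -/
theorem _root_.Literature.ModelTheory.FiniteModelTheory.HF.isBool_bnot {α : Type*} (x : HF α) :
    (HF.bnot x).IsBool := ⟨_, rfl⟩

/-- See `HF.isBool_bnot`. [folklore] -/
theorem _root_.Literature.ModelTheory.FiniteModelTheory.HF.isBool_band {α : Type*} (x y : HF α) :
    (HF.band x y).IsBool := ⟨_, rfl⟩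

/-- See `HF.isBool_bnot`. [folklore] -/
theorem _root_.Literature.ModelTheory.FiniteModelTheory.HF.isBool_bor {α : Type*} (x y : HF α) :
    (HF.bor x y).IsBool := by
  classical
  exact ⟨_, rfl⟩

/-- Writing `true` into `Halt` and a Boolean into `Output`, both previously `∅`, creates no new
critical objects. [Blass–Gurevich–Shelah 1999, §5.1] [folklore] -/
theorem DynState.critical_writeHO_iff {S S' : DynState n} {y : Obj n} (hy : y.IsBool)
    (hS' : ∀ f args, S' f args = if f = haltSym ∧ args = [] then HF.ofBool true
      else if f = outputSym ∧ args = [] then y else S f args)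
    (hH : S haltSym [] = ∅) (hO : S outputSym [] = ∅) (x : Obj n) :
    S'.Critical x ↔ S.Critical x := by
  constructor
  · rintro (h | h | ⟨f, args, hx⟩ | ⟨f, args, hne, hx⟩)
    · exact Or.inl h
    · exact Or.inr (Or.inl h)
    · rw [hS'] at hx
      split_ifs at hx with hA hB
      · exact Or.inr (Or.inl ⟨true, hx.symm⟩)
      · exact Or.inr (Or.inl (hx ▸ hy))
      · exact Or.inr (Or.inr (Or.inl ⟨f, args, hx⟩))
    · rw [hS'] at hne
      split_ifs at hne with hA hB
      · rw [hA.2] at hx; simp at hx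
      · rw [hB.2] at hx; simp at hx
      · exact Or.inr (Or.inr (Or.inr ⟨f, args, hne, hx⟩))
  · rintro (h | h | ⟨f, args, hx⟩ | ⟨f, args, hne, hx⟩)
    · exact Or.inl h
    · exact Or.inr (Or.inl h)
    · by_cases hA : f = haltSym ∧ args = []
      · obtain ⟨rfl, rfl⟩ := hA
        exact Or.inr (Or.inl ⟨false, by rw [← hx, hH, HF.ofBool_false]⟩)
      · by_cases hB : f = outputSym ∧ args = []
        · obtain ⟨rfl, rfl⟩ := hB
          exact Or.inr (Or.inl ⟨false, by rw [← hx, hO, HF.ofBool_false]⟩)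
        · refine Or.inr (Or.inr (Or.inl ⟨f, args, ?_⟩))
          rw [hS', if_neg hA, if_neg hB, hx]
    · have hA : ¬ (f = haltSym ∧ args = []) := by rintro ⟨rfl, rfl⟩; exact hne hH
      have hB : ¬ (f = outputSym ∧ args = []) := by rintro ⟨rfl, rfl⟩; exact hne hO
      refine Or.inr (Or.inr (Or.inr ⟨f, args, ?_, hx⟩))
      rwa [hS', if_neg hA, if_neg hB]

/-! ### The complement program -/

/-- The symbol shift `f ↦ f + 2` freeing `Halt = 0` and `Output = 1`. [folklore] -/
def shift2 (f : ℕ) : ℕ := f + 2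

/-- `shift2` is injective. [folklore] -/
theorem shift2_injective : Function.Injective shift2 := fun _ _ h => Nat.add_right_cancel h

/-- `shift2` misses `Halt`. [folklore] -/
theorem shift2_ne_haltSym (g : ℕ) : shift2 g ≠ haltSym := Nat.succ_ne_zero _

/-- `shift2` misses `Output`. [folklore] -/
theorem shift2_ne_outputSym (g : ℕ) : shift2 g ≠ outputSym := by
  unfold shift2 outputSym; omega

/-- The finishing rule `do-in-parallel Halt := true, Output := ¬ Output' enddo`
(`Output' = dyn 3`). [Blass–Gurevich–Shelah 1999, §6.3 (the same device)] [folklore] -/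
def finishRule : Rule :=
  Rule.par 0 (.update haltSym .nil .cTrue)
    (.update outputSym .nil (.not (.dyn (shift2 outputSym) .nil)))

/-- **The complement rule**: `if Halt' = true then finish else R[f ↦ f + 2] endif`.
[Blass–Gurevich–Shelah 1999, §5.1, §6.3] [folklore] -/
def Rule.complement (R : Rule) : Rule :=
  .cond (.eq (.dyn (shift2 haltSym) .nil) .cTrue) finishRule (R.renameDyn shift2)

/-- The complement rule of a closed rule is closed. [folklore] -/
theorem Rule.FV_complement (R : Rule) (hR : R.FV = ∅) : R.complement.FV = ∅ := by
  have h1 : finishRule.FV = ∅ := by decide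
  rw [Rule.complement, Rule.FV, h1, Rule.FV_renameDyn, hR]
  decide

/-- **The complement program.** [Blass–Gurevich–Shelah 1999, §5.1] [folklore] -/
def Program.complement (P : Program) : Program :=
  ⟨P.rule.complement, Rule.FV_complement P.rule P.closed⟩

section Simulation

variable (P : Program) (G : SimpleGraph (Fin n))

/-- The update set of the finishing rule: `{(Halt, true), (Output, ¬ Output')}`. [folklore] -/
theorem den_finishRule (S : DynState n) (σ : Env n) :
    finishRule.den G S σ = {((haltSym, []), HF.ofBool true),
      ((outputSym, []), HF.bnot (S (shift2 outputSym) []))} := by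
  have h01 : (HF.ofBool false : Obj n) ≠ HF.ofBool true := by simp
  ext u
  simp only [finishRule, Rule.par, Rule.den, Term.eval, Args.eval, Finset.mem_biUnion,
    HF.mem_members, HF.mem_pair, Finset.mem_insert, Finset.mem_singleton]
  constructor
  · rintro ⟨a, ha, hu⟩
    rcases ha with rfl | rfl
    · rw [Function.update_self, eqB_self, if_pos rfl, Finset.mem_singleton] at hu
      exact Or.inl hu
    · rw [Function.update_self, eqB_of_ne h01.symm, if_neg h01, Finset.mem_singleton] at hu
      exact Or.inr hu
  · rintro (rfl | rfl)
    · refine ⟨HF.ofBool false, Or.inl rfl, ?_⟩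
      rw [Function.update_self, eqB_self, if_pos rfl, Finset.mem_singleton]
    · refine ⟨HF.ofBool true, Or.inr rfl, ?_⟩
      rw [Function.update_self, eqB_of_ne h01.symm, if_neg h01, Finset.mem_singleton]

/-- That update set is consistent. [folklore] -/
theorem consistent_den_finishRule (x : Obj n) :
    Consistent ({((haltSym, []), HF.ofBool true), ((outputSym, []), x)} : Finset (Update n)) := by
  intro u hu u' hu' h
  simp only [Finset.mem_insert, Finset.mem_singleton] at hu hu'
  rcases hu with rfl | rfl <;> rcases hu' with rfl | rfl
  · rfl
  · exact absurd (show haltSym = outputSym from congrArg Prod.fst h) (by decide)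
  · exact absurd (show outputSym = haltSym from congrArg Prod.fst h) (by decide)
  · rfl

/-- One step of the complement program BEFORE `Halt'` holds: the shifted copy of `Π` fires, so
the new state seen through the shift is the next state of `Π`, and `Halt`, `Output` are
untouched. [folklore] -/
theorem step_complement_of_ne (S : DynState n) (hS : S (shift2 haltSym) [] ≠ HF.ofBool true) :
    (P.complement.step G S).precomp shift2 = P.step G (S.precomp shift2) ∧
      ∀ f, (∀ g, shift2 g ≠ f) → ∀ args, P.complement.step G S f args = S f args := by
  have hden : P.complement.rule.den G S (fun _ => ∅) =
      ((P.rule.den G (S.precomp shift2) fun _ => ∅).image (renUpd shift2)) := by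
    show (Rule.cond _ finishRule (P.rule.renameDyn shift2)).den G S (fun _ => ∅) = _
    rw [Rule.den, Term.eval, Term.eval, Term.eval, Args.eval, if_neg, Rule.den_renameDyn]
    rw [eqB_of_ne hS, HF.ofBool_eq_ofBool_iff]
    exact Bool.false_ne_true
  refine ⟨?_, fun f hf args => ?_⟩
  · show (fire S (P.complement.rule.den G S fun _ => ∅)).precomp shift2 = _
    rw [hden, precomp_fire_image S shift2_injective]
    rfl
  · show fire S (P.complement.rule.den G S fun _ => ∅) f args = S f args
    rw [hden]
    exact fire_image_apply_of_not_mem_range S hf _ args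

/-- One step of the complement program ONCE `Halt'` holds: `Halt := true`, `Output := ¬Output'`,
nothing else changes. [folklore] -/
theorem step_complement_of_eq (S : DynState n) (hS : S (shift2 haltSym) [] = HF.ofBool true)
    (f : ℕ) (args : List (Obj n)) :
    P.complement.step G S f args =
      if f = haltSym ∧ args = [] then HF.ofBool true
      else if f = outputSym ∧ args = [] then HF.bnot (S (shift2 outputSym) []) else S f args := by
  have hden : P.complement.rule.den G S (fun _ => ∅) = {((haltSym, []), HF.ofBool true),
      ((outputSym, []), HF.bnot (S (shift2 outputSym) []))} := by
    show (Rule.cond _ finishRule (P.rule.renameDyn shift2)).den G S (fun _ => ∅) = _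
    rw [Rule.den, Term.eval, Term.eval, Term.eval, Args.eval, if_pos, den_finishRule]
    rw [hS, eqB_self]
  have hc := consistent_den_finishRule (n := n) (HF.bnot (S (shift2 outputSym) []))
  show fire S (P.complement.rule.den G S fun _ => ∅) f args = _
  rw [hden]
  split_ifs with h1 h2
  · obtain ⟨rfl, rfl⟩ := h1
    exact fire_apply_of_mem hc (by simp)
  · obtain ⟨rfl, rfl⟩ := h2
    exact fire_apply_of_mem hc (by simp)
  · refine fire_apply_of_forall_not_mem fun c hc' => ?_
    simp only [Finset.mem_insert, Finset.mem_singleton, Prod.mk.injEq] at hc'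
    rcases hc' with ⟨⟨rfl, rfl⟩, -⟩ | ⟨⟨rfl, rfl⟩, -⟩
    · exact h1 ⟨rfl, rfl⟩
    · exact h2 ⟨rfl, rfl⟩

variable {P G}

/-- **The simulation**: while `Π` has not halted, the `i`-th state of `Π'` is the `i`-th state of
`Π` on the shifted symbols and `∅` on `Halt`, `Output` (indeed on every unshifted symbol).
[folklore] -/
theorem stateAt_complement {l : ℕ} (hl : ∀ i < l, (P.stateAt G i).halt ≠ HF.ofBool true) :
    ∀ i ≤ l, (P.complement.stateAt G i).precomp shift2 = P.stateAt G i ∧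
      ∀ f, (∀ g, shift2 g ≠ f) → ∀ args, P.complement.stateAt G i f args = ∅ := by
  intro i
  induction i with
  | zero => intro _; exact ⟨rfl, fun _ _ _ => rfl⟩
  | succ i ih =>
    intro hi
    obtain ⟨h1, h2⟩ := ih (Nat.le_of_succ_le hi)
    have hne : P.complement.stateAt G i (shift2 haltSym) [] ≠ HF.ofBool true := by
      have := hl i (Nat.lt_of_succ_le hi)
      rwa [← h1] at this
    obtain ⟨hs1, hs2⟩ := step_complement_of_ne P G (P.complement.stateAt G i) hne
    refine ⟨?_, fun f hf args => ?_⟩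
    · rw [Program.stateAt_succ, Program.stateAt_succ, hs1, h1]
    · rw [Program.stateAt_succ, hs2 f hf args, h2 f hf args]

/-- If `Π` halts at `l`, the complement program at stage `l + 1` has `Halt = true`,
`Output = ¬ Output_Π`, and otherwise the state of stage `l`. [folklore] -/
theorem stateAt_complement_succ {l : ℕ} (hl : P.HaltsAt G l) (f : ℕ) (args : List (Obj n)) :
    P.complement.stateAt G (l + 1) f args =
      if f = haltSym ∧ args = [] then HF.ofBool true
      else if f = outputSym ∧ args = [] then HF.bnot (P.stateAt G l).output
      else P.complement.stateAt G l f args := by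
  obtain ⟨h1, -⟩ := stateAt_complement hl.1 l le_rfl
  have hS : P.complement.stateAt G l (shift2 haltSym) [] = HF.ofBool true := by
    have := hl.2
    rwa [← h1] at this
  rw [Program.stateAt_succ, step_complement_of_eq P G _ hS, ← h1]
  rfl

/-- The complement program halts one step after `Π`. [folklore] -/
theorem haltsAt_complement {l : ℕ} (hl : P.HaltsAt G l) : P.complement.HaltsAt G (l + 1) := by
  refine ⟨fun i hi => ?_, ?_⟩
  · obtain ⟨-, h2⟩ := stateAt_complement hl.1 i (Nat.lt_succ_iff.mp hi)
    rw [DynState.halt, h2 haltSym shift2_ne_haltSym []]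
    exact HF.empty_ne_ordinal_succ 0
  · show P.complement.stateAt G (l + 1) haltSym [] = HF.ofBool true
    rw [stateAt_complement_succ hl, if_pos ⟨rfl, rfl⟩]

/-- Its output is the negation of the output of `Π`. [folklore] -/
theorem output_complement {l : ℕ} (hl : P.HaltsAt G l) (b : Bool)
    (hb : (P.stateAt G l).output = HF.ofBool b) :
    (P.complement.stateAt G (l + 1)).output = HF.ofBool (!b) := by
  show P.complement.stateAt G (l + 1) outputSym [] = HF.ofBool (!b)
  rw [stateAt_complement_succ hl, if_neg (fun h => absurd h.1 (by decide)), if_pos ⟨rfl, rfl⟩, hb,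
    HF.bnot_ofBool]

/-- Before the extra step, the two runs have the same critical objects. [folklore] -/
theorem critical_complement_iff {l : ℕ} (hl : ∀ i < l, (P.stateAt G i).halt ≠ HF.ofBool true)
    {i : ℕ} (hi : i ≤ l) (x : Obj n) :
    (P.complement.stateAt G i).Critical x ↔ (P.stateAt G i).Critical x := by
  obtain ⟨h1, h2⟩ := stateAt_complement hl i hi
  have hval : ∀ g args, P.complement.stateAt G i (shift2 g) args = P.stateAt G i g args :=
    fun g args => by rw [← h1]; rfl
  have hcase : ∀ f, (∀ g, shift2 g ≠ f) ∨ ∃ g, f = shift2 g := fun f => by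
    by_cases h : ∃ g, f = shift2 g
    · exact Or.inr h
    · exact Or.inl fun g hg => h ⟨g, hg.symm⟩
  constructor
  · rintro (h | h | ⟨f, args, hx⟩ | ⟨f, args, hne, hx⟩)
    · exact Or.inl h
    · exact Or.inr (Or.inl h)
    · rcases hcase f with hf | ⟨g, rfl⟩
      · rw [h2 f hf] at hx
        exact Or.inr (Or.inl ⟨false, hx.symm.trans HF.ofBool_false.symm⟩)
      · rw [hval] at hx
        exact Or.inr (Or.inr (Or.inl ⟨g, args, hx⟩))
    · rcases hcase f with hf | ⟨g, rfl⟩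
      · exact (hne (h2 f hf args)).elim
      · rw [hval] at hne
        exact Or.inr (Or.inr (Or.inr ⟨g, args, hne, hx⟩))
  · rintro (h | h | ⟨g, args, hx⟩ | ⟨g, args, hne, hx⟩)
    · exact Or.inl h
    · exact Or.inr (Or.inl h)
    · exact Or.inr (Or.inr (Or.inl ⟨shift2 g, args, by rw [hval, hx]⟩))
    · exact Or.inr (Or.inr (Or.inr ⟨shift2 g, args, by rwa [hval], hx⟩))

/-- Before the extra step, the two runs have the same active objects. [folklore] -/
theorem active_complement_iff {l : ℕ} (hl : ∀ i < l, (P.stateAt G i).halt ≠ HF.ofBool true)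
    {i : ℕ} (hi : i ≤ l) (x : Obj n) :
    (P.complement.stateAt G i).Active x ↔ (P.stateAt G i).Active x := by
  simp only [DynState.Active, critical_complement_iff hl hi]

/-- The extra step creates no new critical objects (it writes Booleans into nullary locations
that held `∅`). [folklore] -/
theorem critical_complement_succ_iff {l : ℕ} (hl : P.HaltsAt G l) (x : Obj n) :
    (P.complement.stateAt G (l + 1)).Critical x ↔ (P.complement.stateAt G l).Critical x := by
  obtain ⟨-, h2⟩ := stateAt_complement hl.1 l le_rfl
  exact DynState.critical_writeHO_iff (HF.isBool_bnot _) (stateAt_complement_succ hl)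
    (h2 _ shift2_ne_haltSym _) (h2 _ shift2_ne_outputSym _) x

/-- **The two runs activate the same objects.** [folklore] -/
theorem activeSet_complement {l : ℕ} (hl : P.HaltsAt G l) :
    P.complement.activeSet G (l + 1) = P.activeSet G l := by
  ext x
  simp only [Program.activeSet, Set.mem_setOf_eq]
  constructor
  · rintro ⟨i, hi, hx⟩
    rcases Nat.lt_succ_iff_lt_or_eq.mp (Nat.lt_succ_iff.mpr hi) with hi' | rfl
    · have hi'' : i ≤ l := Nat.lt_succ_iff.mp hi'
      exact ⟨i, hi'', (active_complement_iff hl.1 hi'' x).mp hx⟩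
    · refine ⟨l, le_rfl, (active_complement_iff hl.1 le_rfl x).mp ?_⟩
      simpa only [DynState.Active, critical_complement_succ_iff hl] using hx
  · rintro ⟨i, hi, hx⟩
    exact ⟨i, Nat.le_succ_of_le hi, (active_complement_iff hl.1 hi x).mpr hx⟩

end Simulation

end BGS

/-! ### Complement closure of CPT+Card -/

/-- **The complement of a bounded program**: `(Π', p + 1, q)`. [Blass–Gurevich–Shelah 1999,
§5.1] [folklore] -/
def CPTCardProgram.complement (P : CPTCardProgram) : CPTCardProgram :=
  ⟨P.prog.complement, P.stepBound + 1, P.activeBound⟩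

/-- If `P` accepts `G` then its complement rejects `G`. [Blass–Gurevich–Shelah 1999, §5.1]
[folklore] -/
theorem CPTCardProgram.complement_rejects {P : CPTCardProgram} {G : FinGraph} (h : P.Accepts G) :
    P.complement.Rejects G := by
  obtain ⟨l, hl, hH, hA, hO⟩ := h
  refine ⟨l + 1, ?_, BGS.haltsAt_complement hH, ?_, ?_⟩
  · show l + 1 ≤ (P.stepBound + 1).eval G.1
    rw [Polynomial.eval_add, Polynomial.eval_one]
    exact Nat.succ_le_succ hl
  · show (P.prog.complement.activeSet G.2 (l + 1)).encard ≤ _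
    rw [BGS.activeSet_complement hH]
    exact hA
  · exact BGS.output_complement hH true hO

/-- If `P` rejects `G` then its complement accepts `G`. [Blass–Gurevich–Shelah 1999, §5.1]
[folklore] -/
theorem CPTCardProgram.complement_accepts {P : CPTCardProgram} {G : FinGraph} (h : P.Rejects G) :
    P.complement.Accepts G := by
  obtain ⟨l, hl, hH, hA, hO⟩ := h
  refine ⟨l + 1, ?_, BGS.haltsAt_complement hH, ?_, ?_⟩
  · show l + 1 ≤ (P.stepBound + 1).eval G.1
    rw [Polynomial.eval_add, Polynomial.eval_one]
    exact Nat.succ_le_succ hl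
  · show (P.prog.complement.activeSet G.2 (l + 1)).encard ≤ _
    rw [BGS.activeSet_complement hH]
    exact hA
  · exact BGS.output_complement hH false hO

/-- The complement program decides the complement class. [Blass–Gurevich–Shelah 1999, §5.1]
[folklore] -/
theorem CPTCardProgram.Decides.complement {P : CPTCardProgram} {C : Set FinGraph}
    (h : P.Decides C) : P.complement.Decides Cᶜ := fun G =>
  ⟨fun hG => CPTCardProgram.complement_accepts ((h G).2 hG),
    fun hG => CPTCardProgram.complement_rejects ((h G).1 (not_not.mp hG))⟩

/-- **CPT+Card is closed under complement.** [Blass–Gurevich–Shelah 1999, §5.1;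
Blass–Gurevich–Shelah 2002, §2] [folklore] -/
theorem CPTCardDefinable.compl {C : Set FinGraph} (h : CPTCardDefinable C) : CPTCardDefinable Cᶜ := by
  obtain ⟨P, hP⟩ := h
  exact ⟨P.complement, hP.complement⟩

/-- Hence `C` is CPT+Card-definable iff its complement is. [folklore] -/
theorem cptCardDefinable_compl_iff {C : Set FinGraph} : CPTCardDefinable Cᶜ ↔ CPTCardDefinable C :=
  ⟨fun h => compl_compl C ▸ h.compl, CPTCardDefinable.compl⟩

/-! ### Intersection and union: running two programs side by side -/

namespace BGS

variable {n : ℕ}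

/-- The symbol renaming of the FIRST program: `f ↦ 2f + 2` (even symbols `≥ 2`). [folklore] -/
def dbl2 (f : ℕ) : ℕ := 2 * f + 2

/-- The symbol renaming of the SECOND program: `f ↦ 2f + 3` (odd symbols `≥ 3`). [folklore] -/
def dbl3 (f : ℕ) : ℕ := 2 * f + 3

/-- `dbl2` is injective. [folklore] -/
theorem dbl2_injective : Function.Injective dbl2 := fun a b h => by unfold dbl2 at h; omega

/-- `dbl3` is injective. [folklore] -/
theorem dbl3_injective : Function.Injective dbl3 := fun a b h => by unfold dbl3 at h; omega

/-- The two renamings have disjoint ranges. [folklore] -/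
theorem dbl2_ne_dbl3 (f g : ℕ) : dbl2 f ≠ dbl3 g := by unfold dbl2 dbl3; omega

/-- `dbl2` misses `Halt` and `Output`. [folklore] -/
theorem dbl2_ne_haltSym (g : ℕ) : dbl2 g ≠ haltSym := by unfold dbl2 haltSym; omega

/-- See `dbl2_ne_haltSym`. [folklore] -/
theorem dbl2_ne_outputSym (g : ℕ) : dbl2 g ≠ outputSym := by unfold dbl2 outputSym; omega

/-- `dbl3` misses `Halt` and `Output`. [folklore] -/
theorem dbl3_ne_haltSym (g : ℕ) : dbl3 g ≠ haltSym := by unfold dbl3 haltSym; omega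

/-- See `dbl3_ne_haltSym`. [folklore] -/
theorem dbl3_ne_outputSym (g : ℕ) : dbl3 g ≠ outputSym := by unfold dbl3 outputSym; omega

/-- Every symbol is `Halt`, `Output`, or in the range of one of the renamings. [folklore] -/
theorem sym_cases (f : ℕ) : f = haltSym ∨ f = outputSym ∨ (∃ g, f = dbl2 g) ∨ ∃ g, f = dbl3 g := by
  rcases Nat.even_or_odd' f with ⟨k, rfl | rfl⟩
  · cases k with
    | zero => exact Or.inl rfl
    | succ k => exact Or.inr (Or.inr (Or.inl ⟨k, by unfold dbl2; ring⟩))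
  · cases k with
    | zero => exact Or.inr (Or.inl rfl)
    | succ k => exact Or.inr (Or.inr (Or.inr ⟨k, by unfold dbl3; ring⟩))

/-- The Boolean term `Halt_ρ = true`. [folklore] -/
def haltedT (ρ : ℕ → ℕ) : Term := .eq (.dyn (ρ haltSym) .nil) .cTrue

/-- `ρ`-renamed `R`, frozen once `Halt_ρ` holds: `if Halt_ρ = true then Skip else R[ρ] endif`.
[Blass–Gurevich–Shelah 1999, §6.3] [folklore] -/
def guarded (ρ : ℕ → ℕ) (R : Rule) : Rule := .cond (haltedT ρ) .skip (R.renameDyn ρ)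

/-- The output term `Output₁ ∧ Output₂` (`useAnd`) or `Output₁ ∨ Output₂`. [folklore] -/
def outT (useAnd : Bool) : Term :=
  if useAnd then .and (.dyn (dbl2 outputSym) .nil) (.dyn (dbl3 outputSym) .nil)
  else .or (.dyn (dbl2 outputSym) .nil) (.dyn (dbl3 outputSym) .nil)

/-- The finishing rule `do-in-parallel Halt := true, Output := outT enddo`. [folklore] -/
def finish2 (useAnd : Bool) : Rule :=
  Rule.par 0 (.update haltSym .nil .cTrue) (.update outputSym .nil (outT useAnd))

/-- **The combined rule**: once both copies have halted, finish; otherwise fire both guarded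
copies in parallel. [Blass–Gurevich–Shelah 1999, §4.5 (do-in-parallel), §6.3] [folklore] -/
def Rule.combine (useAnd : Bool) (R₁ R₂ : Rule) : Rule :=
  .cond (.and (haltedT dbl2) (haltedT dbl3)) (finish2 useAnd)
    (Rule.par 0 (guarded dbl2 R₁) (guarded dbl3 R₂))

/-- `guarded ρ R` is closed if `R` is. [folklore] -/
theorem FV_guarded (ρ : ℕ → ℕ) {R : Rule} (hR : R.FV = ∅) : (guarded ρ R).FV = ∅ := by
  rw [guarded, Rule.FV, Rule.FV_renameDyn, hR]
  rfl

/-- `finish2` is closed. [folklore] -/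
theorem FV_finish2 (useAnd : Bool) : (finish2 useAnd).FV = ∅ := by
  cases useAnd <;> decide

/-- The combined rule of closed rules is closed. [folklore] -/
theorem Rule.FV_combine (useAnd : Bool) {R₁ R₂ : Rule} (h₁ : R₁.FV = ∅) (h₂ : R₂.FV = ∅) :
    (Rule.combine useAnd R₁ R₂).FV = ∅ := by
  have hp : (Rule.par 0 (guarded dbl2 R₁) (guarded dbl3 R₂)).FV = ∅ := by
    rw [Rule.par, Rule.FV, Rule.FV, FV_guarded dbl2 h₁, FV_guarded dbl3 h₂]
    decide
  rw [Rule.combine, Rule.FV, FV_finish2, hp]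
  decide

/-- **The combined program** of `Π₁`, `Π₂`. [Blass–Gurevich–Shelah 1999, §4.5, §6.3] [folklore] -/
def Program.combine (useAnd : Bool) (P₁ P₂ : Program) : Program :=
  ⟨Rule.combine useAnd P₁.rule P₂.rule, Rule.FV_combine useAnd P₁.closed P₂.closed⟩

section Combine

variable (useAnd : Bool) (P₁ P₂ : Program) (G : SimpleGraph (Fin n))

/-- The value of `Halt_ρ = true`. [folklore] -/
theorem eval_haltedT (ρ : ℕ → ℕ) (S : DynState n) (σ : Env n) :
    (haltedT ρ).eval G S σ = HF.ofBool true ↔ S (ρ haltSym) [] = HF.ofBool true := by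
  show eqB (S (ρ haltSym) []) (HF.ofBool true) = HF.ofBool true ↔ _
  exact eqB_eq_true_iff

/-- The update set of a guarded copy: nothing once halted, the renamed update set otherwise.
[folklore] -/
theorem den_guarded (ρ : ℕ → ℕ) (R : Rule) (S : DynState n) (σ : Env n) :
    (guarded ρ R).den G S σ = if S (ρ haltSym) [] = HF.ofBool true then ∅
      else (R.den G (S.precomp ρ) σ).image (renUpd ρ) := by
  rw [guarded, Rule.den]
  by_cases h : S (ρ haltSym) [] = HF.ofBool true
  · rw [if_pos ((eval_haltedT G ρ S σ).mpr h), if_pos h, Rule.den]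
  · rw [if_neg (fun h' => h ((eval_haltedT G ρ S σ).mp h')), if_neg h, Rule.den_renameDyn]

/-- The value of the output term. [folklore] -/
theorem eval_outT (S : DynState n) (σ : Env n) :
    (outT useAnd).eval G S σ = if useAnd then HF.band (S (dbl2 outputSym) []) (S (dbl3 outputSym) [])
      else HF.bor (S (dbl2 outputSym) []) (S (dbl3 outputSym) []) := by
  cases useAnd <;> rfl

/-- The update set of the finishing rule. [folklore] -/
theorem den_finish2 (S : DynState n) (σ : Env n) :
    (finish2 useAnd).den G S σ =
      {((haltSym, []), HF.ofBool true), ((outputSym, []), (outT useAnd).eval G S σ)} := by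
  rw [finish2, den_par, Rule.den, Rule.den, Finset.singleton_union]
  congr 1
  rw [Term.eval_congr_env G S (outT useAnd) (τ := σ)]
  · rfl
  · intro v hv
    cases useAnd <;> simp [outT, Term.FV, Args.FV] at hv

variable {P₁ P₂ G} {l₁ l₂ : ℕ} (h₁ : P₁.HaltsAt G l₁) (h₂ : P₂.HaltsAt G l₂)

/-- `Halt` of the frozen run `Π(min i l)` holds iff `l ≤ i`. [folklore] -/
theorem halt_stateAt_min_eq_iff {P : Program} {l : ℕ} (hl : P.HaltsAt G l) (i : ℕ) :
    (P.stateAt G (min i l)).halt = HF.ofBool true ↔ l ≤ i := by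
  rcases le_or_gt l i with h | h
  · rw [min_eq_right h]; exact ⟨fun _ => h, fun _ => hl.2⟩
  · rw [min_eq_left h.le]; exact ⟨fun h' => (hl.1 i h h').elim, fun h' => (Nat.not_lt.mpr h' h).elim⟩

include h₁ h₂ in
/-- **The simulation**: up to stage `max l₁ l₂`, the state of the combined program is, on the even
symbols, the (frozen) run of `Π₁`, on the odd symbols the (frozen) run of `Π₂`, and `∅` on
`Halt`, `Output`. [Blass–Gurevich–Shelah 1999, §4.6, §6.3] [folklore] -/
theorem stateAt_combine : ∀ i ≤ max l₁ l₂,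
    ((Program.combine useAnd P₁ P₂).stateAt G i).precomp dbl2 = P₁.stateAt G (min i l₁) ∧
    ((Program.combine useAnd P₁ P₂).stateAt G i).precomp dbl3 = P₂.stateAt G (min i l₂) ∧
    (∀ args, (Program.combine useAnd P₁ P₂).stateAt G i haltSym args = ∅) ∧
    (∀ args, (Program.combine useAnd P₁ P₂).stateAt G i outputSym args = ∅) := by
  intro i
  induction i with
  | zero => intro _; exact ⟨rfl, rfl, fun _ => rfl, fun _ => rfl⟩
  | succ i ih =>
    intro hi
    have hi' : i < max l₁ l₂ := Nat.lt_of_succ_le hi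
    obtain ⟨e1, e2, eH, eO⟩ := ih hi'.le
    set S := (Program.combine useAnd P₁ P₂).stateAt G i with hS
    -- the guard `both halted` fails at stage `i`
    have hguard : ¬ (Term.and (haltedT dbl2) (haltedT dbl3)).eval G S (fun _ => ∅) = HF.ofBool true := by
      intro h
      have hb : (haltedT dbl2).eval G S (fun _ => ∅) = HF.ofBool true ∧
          (haltedT dbl3).eval G S (fun _ => ∅) = HF.ofBool true := by
        have := h
        simp only [Term.eval, HF.band, HF.ofBool_eq_ofBool_iff, decide_eq_true_eq] at this
        exact this
      rw [eval_haltedT, eval_haltedT] at hb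
      have hl₁ : l₁ ≤ i := (halt_stateAt_min_eq_iff h₁ i).mp (by rw [← e1]; exact hb.1)
      have hl₂ : l₂ ≤ i := (halt_stateAt_min_eq_iff h₂ i).mp (by rw [← e2]; exact hb.2)
      exact absurd hi' (Nat.not_lt.mpr (max_le hl₁ hl₂))
    -- the two parts of the action
    set A : Finset (Update n) := (guarded dbl2 P₁.rule).den G S (fun _ => ∅) with hA
    set B : Finset (Update n) := (guarded dbl3 P₂.rule).den G S (fun _ => ∅) with hB
    have hden : (Program.combine useAnd P₁ P₂).rule.den G S (fun _ => ∅) = A ∪ B := by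
      show (Rule.cond _ (finish2 useAnd) (Rule.par 0 _ _)).den G S (fun _ => ∅) = A ∪ B
      rw [Rule.den, if_neg hguard, den_par_of_closed 0 (FV_guarded dbl2 P₁.closed)
        (FV_guarded dbl3 P₂.closed)]
    have hstep : (Program.combine useAnd P₁ P₂).stateAt G (i + 1) = fire S (A ∪ B) := by
      rw [Program.stateAt_succ, Program.step, ← hS, hden]
    -- description of `A` and `B`
    have hv1 : S (dbl2 haltSym) [] = (P₁.stateAt G (min i l₁)).halt := by rw [← e1]; rfl
    have hv2 : S (dbl3 haltSym) [] = (P₂.stateAt G (min i l₂)).halt := by rw [← e2]; rfl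
    have hA' : A = if l₁ ≤ i then ∅ else (P₁.rule.den G (P₁.stateAt G i) fun _ => ∅).image (renUpd dbl2) := by
      rw [hA, den_guarded, e1, hv1]
      by_cases hl : l₁ ≤ i
      · rw [if_pos ((halt_stateAt_min_eq_iff h₁ i).mpr hl), if_pos hl]
      · rw [if_neg (fun h => hl ((halt_stateAt_min_eq_iff h₁ i).mp h)), if_neg hl,
          min_eq_left (Nat.lt_of_not_le hl).le]
    have hB' : B = if l₂ ≤ i then ∅ else (P₂.rule.den G (P₂.stateAt G i) fun _ => ∅).image (renUpd dbl3) := by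
      rw [hB, den_guarded, e2, hv2]
      by_cases hl : l₂ ≤ i
      · rw [if_pos ((halt_stateAt_min_eq_iff h₂ i).mpr hl), if_pos hl]
      · rw [if_neg (fun h => hl ((halt_stateAt_min_eq_iff h₂ i).mp h)), if_neg hl,
          min_eq_left (Nat.lt_of_not_le hl).le]
    -- symbols of `A` are even, of `B` odd; both consistent
    have hAsym : ∀ a ∈ A, ∃ g, a.1.1 = dbl2 g := by
      intro a ha
      rw [hA'] at ha
      split_ifs at ha with hl
      · simp at ha
      · obtain ⟨u, -, rfl⟩ := Finset.mem_image.mp ha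
        exact ⟨u.1.1, rfl⟩
    have hBsym : ∀ b ∈ B, ∃ g, b.1.1 = dbl3 g := by
      intro b hb
      rw [hB'] at hb
      split_ifs at hb with hl
      · simp at hb
      · obtain ⟨u, -, rfl⟩ := Finset.mem_image.mp hb
        exact ⟨u.1.1, rfl⟩
    have hAc : Consistent A := by
      rw [hA']
      split_ifs with hl
      · intro u hu; simp at hu
      · exact (consistent_image_renUpd_iff dbl2_injective _).mpr
          (P₁.consistent_den_of_haltsAt h₁ (Nat.lt_of_not_le hl) _)
    have hBc : Consistent B := by
      rw [hB']
      split_ifs with hl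
      · intro u hu; simp at hu
      · exact (consistent_image_renUpd_iff dbl3_injective _).mpr
          (P₂.consistent_den_of_haltsAt h₂ (Nat.lt_of_not_le hl) _)
    refine ⟨?_, ?_, fun args => ?_, fun args => ?_⟩
    · -- even symbols: the first program advances (or stays frozen)
      rw [hstep]
      by_cases hl : l₁ ≤ i
      · have hA0 : A = ∅ := by rw [hA', if_pos hl]
        rw [hA0, Finset.empty_union, min_eq_right (Nat.le_succ_of_le hl)]
        rw [min_eq_right hl] at e1
        rw [← e1]
        funext f args
        exact fire_apply_of_forall_sym_ne S B (fun u hu h => by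
          obtain ⟨g, hg⟩ := hBsym u hu; exact dbl2_ne_dbl3 f g (h.symm.trans hg)) args
      · have hlt : i < l₁ := Nat.lt_of_not_le hl
        have hAU : A = (P₁.rule.den G (P₁.stateAt G i) fun _ => ∅).image (renUpd dbl2) := by
          rw [hA', if_neg hl]
        rw [hAU, precomp_fire_union S dbl2_injective _ hBc (fun b hb g hg => by
          obtain ⟨g', hg'⟩ := hBsym b hb; exact dbl2_ne_dbl3 g g' (hg.trans hg')), e1,
          min_eq_left hlt.le, min_eq_left (Nat.succ_le_of_lt hlt), Program.stateAt_succ]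
        rfl
    · -- odd symbols: the second program advances (or stays frozen)
      rw [hstep, Finset.union_comm]
      by_cases hl : l₂ ≤ i
      · have hB0 : B = ∅ := by rw [hB', if_pos hl]
        rw [hB0, Finset.empty_union, min_eq_right (Nat.le_succ_of_le hl)]
        rw [min_eq_right hl] at e2
        rw [← e2]
        funext f args
        exact fire_apply_of_forall_sym_ne S A (fun u hu h => by
          obtain ⟨g, hg⟩ := hAsym u hu; exact dbl2_ne_dbl3 g f (hg.symm.trans h)) args
      · have hlt : i < l₂ := Nat.lt_of_not_le hl
        have hBU : B = (P₂.rule.den G (P₂.stateAt G i) fun _ => ∅).image (renUpd dbl3) := by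
          rw [hB', if_neg hl]
        rw [hBU, precomp_fire_union S dbl3_injective _ hAc (fun a ha g hg => by
          obtain ⟨g', hg'⟩ := hAsym a ha; exact dbl2_ne_dbl3 g' g (hg'.symm.trans hg.symm)), e2,
          min_eq_left hlt.le, min_eq_left (Nat.succ_le_of_lt hlt), Program.stateAt_succ]
        rfl
    · rw [hstep, fire_apply_of_forall_sym_ne S (A ∪ B), eH]
      intro u hu
      rcases Finset.mem_union.mp hu with hu | hu
      · obtain ⟨g, hg⟩ := hAsym u hu; rw [hg]; exact dbl2_ne_haltSym g
      · obtain ⟨g, hg⟩ := hBsym u hu; rw [hg]; exact dbl3_ne_haltSym g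
    · rw [hstep, fire_apply_of_forall_sym_ne S (A ∪ B), eO]
      intro u hu
      rcases Finset.mem_union.mp hu with hu | hu
      · obtain ⟨g, hg⟩ := hAsym u hu; rw [hg]; exact dbl2_ne_outputSym g
      · obtain ⟨g, hg⟩ := hBsym u hu; rw [hg]; exact dbl3_ne_outputSym g

/-- The output value written by the finishing step. [folklore] -/
def outVal (useAnd : Bool) (x y : Obj n) : Obj n := if useAnd then HF.band x y else HF.bor x y

/-- `outVal` is Boolean. [folklore] -/
theorem isBool_outVal (x y : Obj n) : (outVal useAnd x y).IsBool := by
  unfold outVal; split_ifs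
  · exact HF.isBool_band x y
  · exact HF.isBool_bor x y

/-- `outVal` on truth values. [folklore] -/
theorem outVal_ofBool (b c : Bool) : outVal useAnd (HF.ofBool b : Obj n) (HF.ofBool c) =
    HF.ofBool (if useAnd then b && c else b || c) := by
  unfold outVal; cases useAnd
  · rw [if_neg Bool.false_ne_true, HF.bor_ofBool]; rfl
  · rw [if_pos rfl, HF.band_ofBool]; rfl

include h₁ h₂ in
/-- The finishing step: at stage `max l₁ l₂ + 1` the combined program has `Halt = true`,
`Output = Output₁ ⋆ Output₂`, and otherwise the previous state. [folklore] -/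
theorem stateAt_combine_succ (f : ℕ) (args : List (Obj n)) :
    (Program.combine useAnd P₁ P₂).stateAt G (max l₁ l₂ + 1) f args =
      if f = haltSym ∧ args = [] then HF.ofBool true
      else if f = outputSym ∧ args = [] then
        outVal useAnd (P₁.stateAt G l₁).output (P₂.stateAt G l₂).output
      else (Program.combine useAnd P₁ P₂).stateAt G (max l₁ l₂) f args := by
  obtain ⟨e1, e2, -, -⟩ := stateAt_combine useAnd h₁ h₂ (max l₁ l₂) le_rfl
  rw [min_eq_right (le_max_left _ _)] at e1
  rw [min_eq_right (le_max_right _ _)] at e2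
  set S := (Program.combine useAnd P₁ P₂).stateAt G (max l₁ l₂) with hS
  have hH1 : S (dbl2 haltSym) [] = HF.ofBool true := by
    show S.precomp dbl2 haltSym [] = _; rw [e1]; exact h₁.2
  have hH2 : S (dbl3 haltSym) [] = HF.ofBool true := by
    show S.precomp dbl3 haltSym [] = _; rw [e2]; exact h₂.2
  have hguard : (Term.and (haltedT dbl2) (haltedT dbl3)).eval G S (fun _ => ∅) = HF.ofBool true := by
    have g1 := (eval_haltedT G dbl2 S (fun _ => ∅)).mpr hH1
    have g2 := (eval_haltedT G dbl3 S (fun _ => ∅)).mpr hH2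
    show HF.band _ _ = _
    rw [g1, g2, HF.band_ofBool]; rfl
  have hout : (outT useAnd).eval G S (fun _ => ∅) =
      outVal useAnd (P₁.stateAt G l₁).output (P₂.stateAt G l₂).output := by
    rw [eval_outT, outVal]
    have o1 : S (dbl2 outputSym) [] = (P₁.stateAt G l₁).output := by
      show S.precomp dbl2 outputSym [] = _; rw [e1]; rfl
    have o2 : S (dbl3 outputSym) [] = (P₂.stateAt G l₂).output := by
      show S.precomp dbl3 outputSym [] = _; rw [e2]; rfl
    rw [o1, o2]
  have hden : (Program.combine useAnd P₁ P₂).rule.den G S (fun _ => ∅) =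
      {((haltSym, []), HF.ofBool true),
        ((outputSym, []), outVal useAnd (P₁.stateAt G l₁).output (P₂.stateAt G l₂).output)} := by
    show (Rule.cond _ (finish2 useAnd) (Rule.par 0 _ _)).den G S (fun _ => ∅) = _
    rw [Rule.den, if_pos hguard, den_finish2, hout]
  have hc := consistent_den_finishRule (n := n)
    (outVal useAnd (P₁.stateAt G l₁).output (P₂.stateAt G l₂).output)
  rw [Program.stateAt_succ, Program.step, ← hS, hden]
  split_ifs with hA hB
  · obtain ⟨rfl, rfl⟩ := hA
    exact fire_apply_of_mem hc (by simp)
  · obtain ⟨rfl, rfl⟩ := hB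
    exact fire_apply_of_mem hc (by simp)
  · refine fire_apply_of_forall_not_mem fun c hc' => ?_
    simp only [Finset.mem_insert, Finset.mem_singleton, Prod.mk.injEq] at hc'
    rcases hc' with ⟨⟨rfl, rfl⟩, -⟩ | ⟨⟨rfl, rfl⟩, -⟩
    · exact hA ⟨rfl, rfl⟩
    · exact hB ⟨rfl, rfl⟩

include h₁ h₂ in
/-- The combined program halts at stage `max l₁ l₂ + 1`. [folklore] -/
theorem haltsAt_combine : (Program.combine useAnd P₁ P₂).HaltsAt G (max l₁ l₂ + 1) := by
  refine ⟨fun i hi => ?_, ?_⟩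
  · obtain ⟨-, -, eH, -⟩ := stateAt_combine useAnd h₁ h₂ i (Nat.lt_succ_iff.mp hi)
    rw [DynState.halt, eH]
    exact HF.empty_ne_ordinal_succ 0
  · show (Program.combine useAnd P₁ P₂).stateAt G (max l₁ l₂ + 1) haltSym [] = HF.ofBool true
    rw [stateAt_combine_succ useAnd h₁ h₂, if_pos ⟨rfl, rfl⟩]

include h₁ h₂ in
/-- Its output is `Output₁ ⋆ Output₂`. [folklore] -/
theorem output_combine {b₁ b₂ : Bool} (hb₁ : (P₁.stateAt G l₁).output = HF.ofBool b₁)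
    (hb₂ : (P₂.stateAt G l₂).output = HF.ofBool b₂) :
    ((Program.combine useAnd P₁ P₂).stateAt G (max l₁ l₂ + 1)).output =
      HF.ofBool (if useAnd then b₁ && b₂ else b₁ || b₂) := by
  show (Program.combine useAnd P₁ P₂).stateAt G (max l₁ l₂ + 1) outputSym [] = _
  rw [stateAt_combine_succ useAnd h₁ h₂, if_neg (fun h => absurd h.1 (by decide)),
    if_pos ⟨rfl, rfl⟩, hb₁, hb₂, outVal_ofBool]

include h₁ h₂ in
/-- Up to stage `max l₁ l₂`, the critical objects of the combined run are those of the two frozen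
runs. [Blass–Gurevich–Shelah 1999, §5.1] [folklore] -/
theorem critical_combine_iff {i : ℕ} (hi : i ≤ max l₁ l₂) (x : Obj n) :
    ((Program.combine useAnd P₁ P₂).stateAt G i).Critical x ↔
      (P₁.stateAt G (min i l₁)).Critical x ∨ (P₂.stateAt G (min i l₂)).Critical x := by
  obtain ⟨e1, e2, eH, eO⟩ := stateAt_combine useAnd h₁ h₂ i hi
  set S := (Program.combine useAnd P₁ P₂).stateAt G i with hS
  have v1 : ∀ g args, S (dbl2 g) args = P₁.stateAt G (min i l₁) g args := fun g args => by
    rw [← e1]; rfl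
  have v2 : ∀ g args, S (dbl3 g) args = P₂.stateAt G (min i l₂) g args := fun g args => by
    rw [← e2]; rfl
  constructor
  · rintro (h | h | ⟨f, args, hx⟩ | ⟨f, args, hne, hx⟩)
    · exact Or.inl (Or.inl h)
    · exact Or.inl (Or.inr (Or.inl h))
    · rcases sym_cases f with rfl | rfl | ⟨g, rfl⟩ | ⟨g, rfl⟩
      · rw [eH] at hx; exact Or.inl (Or.inr (Or.inl ⟨false, hx.symm.trans HF.ofBool_false.symm⟩))
      · rw [eO] at hx; exact Or.inl (Or.inr (Or.inl ⟨false, hx.symm.trans HF.ofBool_false.symm⟩))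
      · rw [v1] at hx; exact Or.inl (Or.inr (Or.inr (Or.inl ⟨g, args, hx⟩)))
      · rw [v2] at hx; exact Or.inr (Or.inr (Or.inr (Or.inl ⟨g, args, hx⟩)))
    · rcases sym_cases f with rfl | rfl | ⟨g, rfl⟩ | ⟨g, rfl⟩
      · exact (hne (eH args)).elim
      · exact (hne (eO args)).elim
      · rw [v1] at hne; exact Or.inl (Or.inr (Or.inr (Or.inr ⟨g, args, hne, hx⟩)))
      · rw [v2] at hne; exact Or.inr (Or.inr (Or.inr (Or.inr ⟨g, args, hne, hx⟩)))
  · rintro ((h | h | ⟨g, args, hx⟩ | ⟨g, args, hne, hx⟩) | (h | h | ⟨g, args, hx⟩ | ⟨g, args, hne, hx⟩))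
    · exact Or.inl h
    · exact Or.inr (Or.inl h)
    · exact Or.inr (Or.inr (Or.inl ⟨dbl2 g, args, by rw [v1, hx]⟩))
    · exact Or.inr (Or.inr (Or.inr ⟨dbl2 g, args, by rwa [v1], hx⟩))
    · exact Or.inl h
    · exact Or.inr (Or.inl h)
    · exact Or.inr (Or.inr (Or.inl ⟨dbl3 g, args, by rw [v2, hx]⟩))
    · exact Or.inr (Or.inr (Or.inr ⟨dbl3 g, args, by rwa [v2], hx⟩))

include h₁ h₂ in
/-- Hence the active objects of the combined run are those of the two frozen runs. [folklore] -/
theorem active_combine_iff {i : ℕ} (hi : i ≤ max l₁ l₂) (x : Obj n) :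
    ((Program.combine useAnd P₁ P₂).stateAt G i).Active x ↔
      (P₁.stateAt G (min i l₁)).Active x ∨ (P₂.stateAt G (min i l₂)).Active x := by
  simp only [DynState.Active, critical_combine_iff useAnd h₁ h₂ hi, or_and_right, exists_or]

include h₁ h₂ in
/-- The finishing step creates no new critical objects. [folklore] -/
theorem critical_combine_succ_iff (x : Obj n) :
    ((Program.combine useAnd P₁ P₂).stateAt G (max l₁ l₂ + 1)).Critical x ↔
      ((Program.combine useAnd P₁ P₂).stateAt G (max l₁ l₂)).Critical x := by
  obtain ⟨-, -, eH, eO⟩ := stateAt_combine useAnd h₁ h₂ (max l₁ l₂) le_rfl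
  exact DynState.critical_writeHO_iff (isBool_outVal useAnd _ _)
    (stateAt_combine_succ useAnd h₁ h₂) (eH _) (eO _) x

include h₁ h₂ in
/-- **The combined run activates exactly the objects activated by the two runs.** [folklore] -/
theorem activeSet_combine :
    (Program.combine useAnd P₁ P₂).activeSet G (max l₁ l₂ + 1) =
      P₁.activeSet G l₁ ∪ P₂.activeSet G l₂ := by
  ext x
  simp only [Program.activeSet, Set.mem_setOf_eq, Set.mem_union]
  constructor
  · rintro ⟨i, hi, hx⟩
    -- reduce stage `max + 1` to stage `max`
    have hx' : ∃ j ≤ max l₁ l₂, ((Program.combine useAnd P₁ P₂).stateAt G j).Active x := by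
      rcases Nat.lt_succ_iff_lt_or_eq.mp (Nat.lt_succ_iff.mpr hi) with hi' | rfl
      · exact ⟨i, Nat.lt_succ_iff.mp hi', hx⟩
      · refine ⟨max l₁ l₂, le_rfl, ?_⟩
        simpa only [DynState.Active, critical_combine_succ_iff useAnd h₁ h₂] using hx
    obtain ⟨j, hj, hxj⟩ := hx'
    rcases (active_combine_iff useAnd h₁ h₂ hj x).mp hxj with h | h
    · exact Or.inl ⟨min j l₁, min_le_right _ _, h⟩
    · exact Or.inr ⟨min j l₂, min_le_right _ _, h⟩
  · rintro (⟨i, hi, hx⟩ | ⟨i, hi, hx⟩)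
    · refine ⟨i, Nat.le_succ_of_le (le_trans hi (le_max_left _ _)), ?_⟩
      rw [active_combine_iff useAnd h₁ h₂ (le_trans hi (le_max_left _ _)), min_eq_left hi]
      exact Or.inl hx
    · refine ⟨i, Nat.le_succ_of_le (le_trans hi (le_max_right _ _)), ?_⟩
      rw [active_combine_iff useAnd h₁ h₂ (le_trans hi (le_max_right _ _)), min_eq_left hi]
      exact Or.inr hx

end Combine

end BGS

/-! ### Intersection and union closure of CPT+Card -/

/-- **The conjunction / disjunction of two bounded programs**: `(Π⋆, p₁ + p₂ + 1, q₁ + q₂)`.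
[Blass–Gurevich–Shelah 1999, §4.5, §5.1] [folklore] -/
def CPTCardProgram.combine (useAnd : Bool) (P₁ P₂ : CPTCardProgram) : CPTCardProgram :=
  ⟨BGS.Program.combine useAnd P₁.prog P₂.prog, P₁.stepBound + P₂.stepBound + 1,
    P₁.activeBound + P₂.activeBound⟩

/-- The halting data of an accepted or rejected input. [folklore] -/
theorem CPTCardProgram.exists_halt_of_accepts_or_rejects {P : CPTCardProgram} {G : FinGraph}
    {b : Bool} (h : if b then P.Accepts G else P.Rejects G) :
    ∃ l, l ≤ P.stepBound.eval G.1 ∧ P.prog.HaltsAt G.2 l ∧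
      (P.prog.activeSet G.2 l).encard ≤ ((P.activeBound.eval G.1 : ℕ) : ℕ∞) ∧
      (P.prog.stateAt G.2 l).output = HF.ofBool b := by
  cases b
  · exact h
  · exact h

/-- **The combined program computes `⋆` of the two answers**: if `P₁` answers `b₁` and `P₂`
answers `b₂` on `G`, the combined program answers `b₁ ∧ b₂` (resp. `b₁ ∨ b₂`). [folklore] -/
theorem CPTCardProgram.combine_answers (useAnd : Bool) {P₁ P₂ : CPTCardProgram} {G : FinGraph}
    {b₁ b₂ : Bool} (hP₁ : if b₁ then P₁.Accepts G else P₁.Rejects G)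
    (hP₂ : if b₂ then P₂.Accepts G else P₂.Rejects G) :
    let b := if useAnd then b₁ && b₂ else b₁ || b₂
    if b then (P₁.combine useAnd P₂).Accepts G else (P₁.combine useAnd P₂).Rejects G := by
  obtain ⟨l₁, hl₁, hH₁, hA₁, hO₁⟩ := CPTCardProgram.exists_halt_of_accepts_or_rejects hP₁
  obtain ⟨l₂, hl₂, hH₂, hA₂, hO₂⟩ := CPTCardProgram.exists_halt_of_accepts_or_rejects hP₂
  have hsteps : max l₁ l₂ + 1 ≤ (P₁.stepBound + P₂.stepBound + 1).eval G.1 := by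
    rw [Polynomial.eval_add, Polynomial.eval_add, Polynomial.eval_one]
    omega
  have hact : ((P₁.combine useAnd P₂).prog.activeSet G.2 (max l₁ l₂ + 1)).encard ≤
      (((P₁.activeBound + P₂.activeBound).eval G.1 : ℕ) : ℕ∞) := by
    show ((BGS.Program.combine useAnd P₁.prog P₂.prog).activeSet G.2 (max l₁ l₂ + 1)).encard ≤ _
    rw [BGS.activeSet_combine useAnd hH₁ hH₂, Polynomial.eval_add, Nat.cast_add]
    exact (Set.encard_union_le _ _).trans (add_le_add hA₁ hA₂)
  have hout := BGS.output_combine useAnd hH₁ hH₂ hO₁ hO₂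
  intro b
  by_cases hb : b = true
  · rw [if_pos hb]
    refine ⟨max l₁ l₂ + 1, hsteps, BGS.haltsAt_combine useAnd hH₁ hH₂, hact, ?_⟩
    rw [← hb]; exact hout
  · rw [if_neg hb]
    refine ⟨max l₁ l₂ + 1, hsteps, BGS.haltsAt_combine useAnd hH₁ hH₂, hact, ?_⟩
    rw [Bool.not_eq_true] at hb
    rw [← hb]; exact hout

/-- A deciding program answers `G ∈ C` on every input. [folklore] -/
theorem CPTCardProgram.Decides.answers {P : CPTCardProgram} {C : Set FinGraph} (h : P.Decides C)
    (G : FinGraph) [Decidable (G ∈ C)] :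
    if decide (G ∈ C) then P.Accepts G else P.Rejects G := by
  by_cases hG : G ∈ C
  · rw [decide_eq_true hG, if_pos rfl]; exact (h G).1 hG
  · rw [decide_eq_false hG, if_neg Bool.false_ne_true]; exact (h G).2 hG

/-- The conjunction program decides the intersection. [Blass–Gurevich–Shelah 1999, §5.1]
[folklore] -/
theorem CPTCardProgram.Decides.inter {P₁ P₂ : CPTCardProgram} {C₁ C₂ : Set FinGraph}
    (h₁ : P₁.Decides C₁) (h₂ : P₂.Decides C₂) : (P₁.combine true P₂).Decides (C₁ ∩ C₂) := by
  classical
  intro G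
  have key := CPTCardProgram.combine_answers true (h₁.answers G) (h₂.answers G)
  simp only [if_true] at key
  constructor
  · rintro ⟨hG₁, hG₂⟩
    simpa [hG₁, hG₂] using key
  · intro hG
    have : (decide (G ∈ C₁) && decide (G ∈ C₂)) = false := by
      simpa [Bool.and_eq_false_iff, decide_eq_false_iff_not, Set.mem_inter_iff, not_and_or] using hG
    simpa [this] using key

/-- The disjunction program decides the union. [Blass–Gurevich–Shelah 1999, §5.1] [folklore] -/
theorem CPTCardProgram.Decides.union {P₁ P₂ : CPTCardProgram} {C₁ C₂ : Set FinGraph}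
    (h₁ : P₁.Decides C₁) (h₂ : P₂.Decides C₂) : (P₁.combine false P₂).Decides (C₁ ∪ C₂) := by
  classical
  intro G
  have key := CPTCardProgram.combine_answers false (h₁.answers G) (h₂.answers G)
  simp only [Bool.false_eq_true, if_false] at key
  constructor
  · intro hG
    have : (decide (G ∈ C₁) || decide (G ∈ C₂)) = true := by
      simpa [Bool.or_eq_true, decide_eq_true_eq, Set.mem_union] using hG
    simpa [this] using key
  · intro hG
    have : (decide (G ∈ C₁) || decide (G ∈ C₂)) = false := by
      simpa [Bool.or_eq_false_iff, decide_eq_false_iff_not, Set.mem_union, not_or] using hG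
    simpa [this] using key

/-- **CPT+Card is closed under intersection.** [Blass–Gurevich–Shelah 1999, §5.1; 2002, §2]
[folklore] -/
theorem CPTCardDefinable.inter {C D : Set FinGraph} (hC : CPTCardDefinable C)
    (hD : CPTCardDefinable D) : CPTCardDefinable (C ∩ D) := by
  obtain ⟨P, hP⟩ := hC
  obtain ⟨Q, hQ⟩ := hD
  exact ⟨P.combine true Q, hP.inter hQ⟩

/-- **CPT+Card is closed under union.** [Blass–Gurevich–Shelah 1999, §5.1; 2002, §2] [folklore] -/
theorem CPTCardDefinable.union {C D : Set FinGraph} (hC : CPTCardDefinable C)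
    (hD : CPTCardDefinable D) : CPTCardDefinable (C ∪ D) := by
  obtain ⟨P, hP⟩ := hC
  obtain ⟨Q, hQ⟩ := hD
  exact ⟨P.combine false Q, hP.union hQ⟩

/-! ### Monotonicity in the bounds and the normal form `n ^ k + k` -/

/-- Acceptance is monotone in the two bounds. [Blass–Gurevich–Shelah 1999, §5.1 ("increasing the
polynomial bound may increase these classes")] [folklore] -/
theorem CPTCardProgram.accepts_of_le {P : CPTCardProgram} {p' q' : Polynomial ℕ} {G : FinGraph}
    (hp : P.stepBound.eval G.1 ≤ p'.eval G.1) (hq : P.activeBound.eval G.1 ≤ q'.eval G.1)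
    (h : P.Accepts G) : (⟨P.prog, p', q'⟩ : CPTCardProgram).Accepts G := by
  obtain ⟨l, hl, hH, hA, hO⟩ := h
  exact ⟨l, hl.trans hp, hH, hA.trans (by exact_mod_cast hq), hO⟩

/-- Rejection is monotone in the two bounds. [Blass–Gurevich–Shelah 1999, §5.1] [folklore] -/
theorem CPTCardProgram.rejects_of_le {P : CPTCardProgram} {p' q' : Polynomial ℕ} {G : FinGraph}
    (hp : P.stepBound.eval G.1 ≤ p'.eval G.1) (hq : P.activeBound.eval G.1 ≤ q'.eval G.1)
    (h : P.Rejects G) : (⟨P.prog, p', q'⟩ : CPTCardProgram).Rejects G := by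
  obtain ⟨l, hl, hH, hA, hO⟩ := h
  exact ⟨l, hl.trans hp, hH, hA.trans (by exact_mod_cast hq), hO⟩

/-- Deciding is monotone in the two bounds (pointwise larger polynomials). [folklore] -/
theorem CPTCardProgram.Decides.of_le {P : CPTCardProgram} {p' q' : Polynomial ℕ} {C : Set FinGraph}
    (hp : ∀ n, P.stepBound.eval n ≤ p'.eval n) (hq : ∀ n, P.activeBound.eval n ≤ q'.eval n)
    (h : P.Decides C) : (⟨P.prog, p', q'⟩ : CPTCardProgram).Decides C := fun G =>
  ⟨fun hG => CPTCardProgram.accepts_of_le (hp _) (hq _) ((h G).1 hG),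
    fun hG => CPTCardProgram.rejects_of_le (hp _) (hq _) ((h G).2 hG)⟩

/-- Every `ℕ`-polynomial is bounded by `n ↦ n ^ e + e` for some `e` (the tree's normal form of
polynomial clocks, cf. `GurevichLogic.compile_spec`). [folklore] -/
theorem exists_eval_le_pow_add_self' (q : Polynomial ℕ) : ∃ e : ℕ, ∀ n : ℕ, q.eval n ≤ n ^ e + e := by
  obtain ⟨c, k, hck⟩ := Literature.Computability.Complexity.exists_eval_le_mul_pow_add q
  refine ⟨k + 1 + (c ^ (k + 1) + c), fun n => (hck n).trans ?_⟩
  have hmain : c * n ^ k + c ≤ n ^ (k + 1) + (c ^ (k + 1) + c) := by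
    rcases le_or_gt c n with hcn | hnc
    · have : c * n ^ k ≤ n ^ (k + 1) := by
        rw [pow_succ']
        exact Nat.mul_le_mul_right _ hcn
      omega
    · have : c * n ^ k ≤ c ^ (k + 1) := by
        rw [pow_succ']
        exact Nat.mul_le_mul_left _ (Nat.pow_le_pow_left hnc.le k)
      omega
  refine hmain.trans (Nat.add_le_add ?_ (Nat.le_add_left _ _))
  rcases Nat.eq_zero_or_pos n with rfl | hn
  · simp
  · exact Nat.pow_le_pow_right hn (Nat.le_add_right _ _)

/-- **Normal form of bounded programs**: a class is CPT+Card-definable iff it is decided by a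
bounded program with both bounds `n ^ k + k` — so CPT+Card "sentences" may be taken to be the
(encodable) pairs `(Π, k)`. [Blass–Gurevich–Shelah 1999, §5.1] [folklore] -/
theorem cptCardDefinable_iff_exists_pow (C : Set FinGraph) :
    CPTCardDefinable C ↔ ∃ (prog : BGS.Program) (k : ℕ),
      (⟨prog, Polynomial.X ^ k + (k : Polynomial ℕ), Polynomial.X ^ k + (k : Polynomial ℕ)⟩ :
        CPTCardProgram).Decides C := by
  constructor
  · rintro ⟨P, hP⟩
    obtain ⟨k, hk⟩ := exists_eval_le_pow_add_self' (P.stepBound + P.activeBound)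
    refine ⟨P.prog, k, hP.of_le (fun n => ?_) (fun n => ?_)⟩
    · have := hk n
      rw [Polynomial.eval_add] at this
      simp only [Polynomial.eval_add, Polynomial.eval_pow, Polynomial.eval_X, Polynomial.eval_natCast,
        Nat.cast_id]
      omega
    · have := hk n
      rw [Polynomial.eval_add] at this
      simp only [Polynomial.eval_add, Polynomial.eval_pow, Polynomial.eval_X, Polynomial.eval_natCast,
        Nat.cast_id]
      omega
  · rintro ⟨prog, k, h⟩
    exact ⟨_, h⟩

end Literature.ModelTheory.FiniteModelTheory
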